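import Summits.HodgeConjecture.HodgeConjecture.Theorems.HodgeLocusCensusValJ0At3

/-!
# Hodge locus census — V3-XT, N = 1: depth `≥ 12` at `j = 0` (`ℓ = 3`) — the depth–theta dictionary and Nekovář's weight-3/2 coefficient (engine A, abs-1 gen 26, ROW 3)

HONEST FRAMING: certified instances and evidence bearing on the general Hodge conjecture; no claim.

Setting (THEOREM T-0@3, `HodgeLocusCensusValJ0At3`): `D = -3M`, `3 ∤ M`; a class of discriminant `D`
is an orbit of admissible vectors `φ = b i + c j + d k` of the maximal order of `(-1,-3)_ℚ`
(`b² + 3c² + 3d² = 3M`, `c ≡ D`, `b ≡ d (mod 2)`; six vectors per class), and the normalised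
valuation of `j` at a prime over `3` is `v' = vLaw0 b d = 3 (1 + v₃(b² + 3d²)) = 6 + 3 v₃(d² + 3b'²)`
(`b = 3b'`).  This file is the finite algebraic core of the DICTIONARY

  `ν'_m(M) := #{classes with v' ≥ 6 + 3m} = (1/6) · r(M ; c² + 4·3^m (x² - xy + y²))`   (`M` odd squarefree),

derived in `code/abs_engineA/xt/n1depth12/DERIVATION-N12-A.md` (§2.1) of the pub-hlocus cell and certified against the
two-engine census (1006/1006 discriminants, `m = 0..6`), together with the arithmetic skeleton of THEOREM N12 (§2.3–2.4 there):
for squarefree `M ≡ 1 (mod 12)`, Nekovář's normalised coefficient `c'(M)` of `F₊ = η(6z)η(18z)θ(9z)` [Nekovar1990, Prop. 6.4,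
Thm. 6.6] equals `-(h(-3M)/2 - 3ν'_2(M))/2`, whence `L(E_M,1) = (3Ω₊/4)(h/2 - 3ν'_2)²/√M` for the quadratic twist `E_M : MY² = 4X³ - 27`
of `X₀(27)`, `L(E_M,1) = 0 ⟺` exactly `h/6` classes have `v' ≥ 12`, and `c'(M) ≡ -h(-3M) (mod 3)` ([Nekovar1990, (7.1)]).  Contents:
* `depth_ge_iff` — the threshold: `6 + 3m ≤ v'` iff `3^m ∣ d² + 3b'²`;
* `sqrt_neg_three_step`, `step_parity`, `three_pow_step` — the `(√-3)`-adic step in `ℤ[√-3]`: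
  `3 ∣ d² + 3b'²` forces `3 ∣ d`, and `(d, b') ↦ (b', d/3)` divides the norm by `3` and preserves the
  parity relation `d ≡ b' (mod 2)`; iterated, `3^m ∣ d² + 3b'²` iff the pair descends `m` times;
* `eisenstein_norm_four`, `same_parity_of_norm`, `norm_of_same_parity` — same-parity pairs `(X, Y)` with
  `X² + 3Y² = 4L` are exactly the images `X = 2x - y, Y = y` of the Eisenstein integers `x + yρ` of norm
  `L = x² - xy + y²`, which turns the vector count into `r(M ; c² + 4·3^m(x² - xy + y²))`;
* `levels` — the levels `4·3^(m+1)` of the generating functions `θ(z) Θ_{A₂}(4·3^m z)`: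
  `12` (class numbers), `36` (the genus law (G)), `108` (depth `≥ 12`: the first level beyond genus theory);
* `anchor_13`, `anchor_37` — the counts for `M = 13` (`h = 4`: `ν' = (4, 2, 0)`, `t = 2`) and `M = 37`
  (`h = 8`: `ν' = (8, 4, 2)`, `t = -2`) by `decide +kernel` over the complete boxes `|c| ≤ √M`, `|x|, |y| ≤ √(M/3)` (since `x² - xy + y² ≥ (3/4) max(x², y²)`);
* `sturm_numerals`, `units_mod_24_square`, `progressions` — the level/index/residue bookkeeping of the Sturm argument for the
  coefficient identity (N) (`[SL₂(ℤ):Γ₀(1728)] = 3456`, bound `1728 < 4·433`; `(c,6)=1 ⇒ c² ≡ 1 (mod 24)`; `-3M mod 8`);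
* `c_prime_uniform`, `three_dvd_c`, `t_even`, `N12_assembly`, `nekovar_congruence`, `nonvanishing_criterion` — the
  arithmetic of THEOREM N12: from `2c + 3t = 0` resp. `2c + t = 0` the normalised coefficient is `c' = -t/2` in both residue
  classes, `3 ∣ c` when `M ≡ 1 (mod 24)`, `t` is even; with `t = h/2 - 3ν₂` and `A = 3c'²` (Nekovář's Thm 6.6 normalised by `Ω₊√M`)
  one gets `A = (3/4)t²` and `A = 0 ↔ 6ν₂ = h`; and `2c' = 3ν₂ - h/2` forces `3 ∣ c' + h` (the congruence (7.1)), hence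
  `3 ∤ h ⇒ c' ≠ 0`.  The modular input (identity (N), Nekovář's theorem) is NOT formalised here — only its arithmetic consequences.

politeness: helper file, no `def`s, no new axioms, `lean check` rc 0, 0 sorries.
-/

namespace Summit.HodgeConjecture.HodgeConjecture.HodgeLocus.Census.Depth12At3

open Summit.HodgeConjecture.HodgeConjecture.HodgeLocus.Census.ValJ0At3

/-! ### The threshold -/

/-- Depth `≥ 6 + 3m` at `j = 0` is the divisibility `3^m ∣ d² + 3b'²` (`b = 3b'`). [derived: T-0@3] -/
theorem depth_ge_iff {b' d m : ℕ} (hne : d ^ 2 + 3 * b' ^ 2 ≠ 0) :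
    6 + 3 * m ≤ vLaw0 (3 * b') d ↔ 3 ^ m ∣ d ^ 2 + 3 * b' ^ 2 := by
  have h3 : Fact (Nat.Prime 3) := ⟨by norm_num⟩
  rw [vLaw0_three_mul b' d hne, padicValNat_dvd_iff_le hne]
  omega

/-- The depth levels are `6, 9, 12, 15, …`: `v' ≡ 0 (mod 3)` and `v' ≥ 6` on vectors with `b = 3b'`. -/
theorem depth_levels (b' d : ℕ) (hne : d ^ 2 + 3 * b' ^ 2 ≠ 0) :
    3 ∣ vLaw0 (3 * b') d ∧ 6 ≤ vLaw0 (3 * b') d := by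
  rw [vLaw0_three_mul b' d hne]
  exact ⟨⟨2 + padicValNat 3 (d ^ 2 + 3 * b' ^ 2), by ring⟩, by omega⟩

/-! ### The `(√-3)`-adic step in `ℤ[√-3]` -/

/-- `3 ∣ d² + 3b'²` forces `3 ∣ d`. -/
theorem three_dvd_of_norm {d b' : ℤ} (h : (3 : ℤ) ∣ d ^ 2 + 3 * b' ^ 2) : 3 ∣ d := by
  have h1 : (3 : ℤ) ∣ d ^ 2 := by
    have : (3 : ℤ) ∣ 3 * b' ^ 2 := dvd_mul_right 3 _
    exact (dvd_add_left this).mp h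
  exact Int.Prime.dvd_pow' (by norm_num) h1

/-- The step: dividing `d + b'√-3` by `√-3` gives `b' - d'√-3` (`d = 3d'`), of norm one third:
`d² + 3b'² = 3 (b'² + 3d'²)`. -/
theorem sqrt_neg_three_step (d' b' : ℤ) :
    (3 * d') ^ 2 + 3 * b' ^ 2 = 3 * (b' ^ 2 + 3 * d' ^ 2) := by ring

/-- The step preserves the parity relation between the two coordinates:
`3d' ≡ b' (mod 2)` iff `b' ≡ d' (mod 2)`. -/
theorem step_parity (d' b' : ℤ) : (2 : ℤ) ∣ 3 * d' - b' ↔ 2 ∣ b' - d' := by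
  constructor
  · rintro ⟨k, hk⟩; exact ⟨d' - k, by linarith⟩
  · rintro ⟨k, hk⟩; exact ⟨d' - k, by linarith⟩

/-- One level up: `3^(m+1) ∣ d² + 3b'²` iff `3 ∣ d` and `3^m` divides the norm of the descended pair. -/
theorem three_pow_step (d b' : ℤ) (m : ℕ) :
    (3 : ℤ) ^ (m + 1) ∣ d ^ 2 + 3 * b' ^ 2 ↔
      ∃ d' : ℤ, d = 3 * d' ∧ (3 : ℤ) ^ m ∣ b' ^ 2 + 3 * d' ^ 2 := by
  constructor
  · intro h
    have h3 : (3 : ℤ) ∣ d ^ 2 + 3 * b' ^ 2 := (dvd_pow_self 3 (Nat.succ_ne_zero m)).trans h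
    obtain ⟨d', rfl⟩ := three_dvd_of_norm h3
    refine ⟨d', rfl, ?_⟩
    rw [sqrt_neg_three_step, pow_succ'] at h
    exact (mul_dvd_mul_iff_left (by norm_num : (3 : ℤ) ≠ 0)).mp h
  · rintro ⟨d', rfl, h⟩
    rw [sqrt_neg_three_step, pow_succ']
    exact mul_dvd_mul_left 3 h

/-! ### Same-parity pairs and Eisenstein integers -/

/-- `4 (x² - xy + y²) = (2x - y)² + 3y²`. -/
theorem eisenstein_norm_four (x y : ℤ) : 4 * (x ^ 2 - x * y + y ^ 2) = (2 * x - y) ^ 2 + 3 * y ^ 2 := by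
  ring

/-- A pair `(X, Y)` with `4 ∣ X² + 3Y²` has `X ≡ Y (mod 2)`. [residues mod 4] -/
theorem same_parity_of_norm {X Y : ℤ} (h : (4 : ℤ) ∣ X ^ 2 + 3 * Y ^ 2) : 2 ∣ X - Y := by
  rcases Int.even_or_odd X with ⟨a, ha⟩ | hX <;> rcases Int.even_or_odd Y with ⟨b, hb⟩ | hY
  · exact ⟨a - b, by omega⟩
  · exfalso
    have hY2 : Y ^ 2 % 4 = 1 := Int.sq_mod_four_eq_one_of_odd hY
    have hX2 : X ^ 2 = 4 * a ^ 2 := by rw [ha]; ring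
    obtain ⟨t, ht⟩ := h
    generalize X ^ 2 = U at *
    generalize Y ^ 2 = V at *
    generalize a ^ 2 = W at *
    omega
  · exfalso
    have hX2 : X ^ 2 % 4 = 1 := Int.sq_mod_four_eq_one_of_odd hX
    have hY2 : Y ^ 2 = 4 * b ^ 2 := by rw [hb]; ring
    obtain ⟨t, ht⟩ := h
    generalize X ^ 2 = U at *
    generalize Y ^ 2 = V at *
    generalize b ^ 2 = W at *
    omega
  · obtain ⟨a, ha⟩ := hX
    obtain ⟨b, hb⟩ := hY
    exact ⟨a - b, by omega⟩

/-- Conversely a same-parity pair is the image of an Eisenstein integer: `X = 2x - Y` with `x = (X + Y)/2`,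
and then `X² + 3Y² = 4 (x² - xY + Y²)`. -/
theorem norm_of_same_parity {X Y : ℤ} (h : (2 : ℤ) ∣ X - Y) :
    ∃ x : ℤ, X = 2 * x - Y ∧ X ^ 2 + 3 * Y ^ 2 = 4 * (x ^ 2 - x * Y + Y ^ 2) := by
  obtain ⟨k, hk⟩ := h
  exact ⟨k + Y, by linarith, by rw [show X = 2 * (k + Y) - Y by linarith]; ring⟩

/-- Assembly of the substitution: a vector coordinate pair `(d, b')` at depth level `m`, i.e.
`d² + 3b'² = 3^m · N` with the descended pair `(X, Y)`, `X² + 3Y² = N = 4L`, `X = 2x - Y`, contributes the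
representation `c² + 4·3^m·(x² - xY + Y²) = M` of the ternary form of the dictionary. [bookkeeping over ℤ] -/
theorem dictionary_substitution {M c d b' X Y x : ℤ} {m : ℕ}
    (hM : c ^ 2 + (d ^ 2 + 3 * b' ^ 2) = M) (hlev : d ^ 2 + 3 * b' ^ 2 = 3 ^ m * (X ^ 2 + 3 * Y ^ 2))
    (hx : X = 2 * x - Y) :
    c ^ 2 + 4 * 3 ^ m * (x ^ 2 - x * Y + Y ^ 2) = M := by
  subst hx
  rw [← hM, hlev]
  ring

/-! ### Levels of the generating functions and anchors -/

/-- `θ(z) Θ_{A₂}(4·3^m z)` has level `4 · 3^(m+1)`: `12, 36, 108, 324` for `m = 0, 1, 2, 3`; the class-number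
level `12`, the genus level `36`, and `108 = 4 · 27` (Shimura lift to weight `2`, level `54 ∋ 27`). [numerals] -/
theorem levels : 4 * 3 ^ (0 + 1) = 12 ∧ 4 * 3 ^ (1 + 1) = 36 ∧ 4 * 3 ^ (2 + 1) = 108 ∧ 4 * 3 ^ (3 + 1) = 324 ∧
    108 = 4 * 27 ∧ 54 = 2 * 27 := by norm_num

/-- Anchor `M = 13` (`D = -39`, `h = 4`): `r(13; c² + 4Θ) = 24`, `r(13; c² + 12Θ) = 12`, `r(13; c² + 36Θ) = 0`,
i.e. `ν' = (4, 2, 0)` — all of depth `6` or `9`, as the census shows. [decide] -/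
theorem anchor_13 :
    ((Finset.Icc (-3 : ℤ) 3 ×ˢ Finset.Icc (-2 : ℤ) 2 ×ˢ Finset.Icc (-2 : ℤ) 2).filter
        (fun p => p.1 ^ 2 + 4 * (p.2.1 ^ 2 - p.2.1 * p.2.2 + p.2.2 ^ 2) = 13)).card = 24 ∧
    ((Finset.Icc (-3 : ℤ) 3 ×ˢ Finset.Icc (-2 : ℤ) 2 ×ˢ Finset.Icc (-2 : ℤ) 2).filter
        (fun p => p.1 ^ 2 + 12 * (p.2.1 ^ 2 - p.2.1 * p.2.2 + p.2.2 ^ 2) = 13)).card = 12 ∧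
    ((Finset.Icc (-3 : ℤ) 3 ×ˢ Finset.Icc (-2 : ℤ) 2 ×ˢ Finset.Icc (-2 : ℤ) 2).filter
        (fun p => p.1 ^ 2 + 36 * (p.2.1 ^ 2 - p.2.1 * p.2.2 + p.2.2 ^ 2) = 13)).card = 0 := by
  refine ⟨by decide +kernel, by decide +kernel, by decide +kernel⟩

/-- Anchor `M = 37` (`D = -111`, `h = 8`): counts `48, 24, 12`, i.e. `ν' = (8, 4, 2)`: two classes reach
depth `12`. [decide] -/
theorem anchor_37 :
    ((Finset.Icc (-6 : ℤ) 6 ×ˢ Finset.Icc (-3 : ℤ) 3 ×ˢ Finset.Icc (-3 : ℤ) 3).filter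
        (fun p => p.1 ^ 2 + 4 * (p.2.1 ^ 2 - p.2.1 * p.2.2 + p.2.2 ^ 2) = 37)).card = 48 ∧
    ((Finset.Icc (-6 : ℤ) 6 ×ˢ Finset.Icc (-3 : ℤ) 3 ×ˢ Finset.Icc (-3 : ℤ) 3).filter
        (fun p => p.1 ^ 2 + 12 * (p.2.1 ^ 2 - p.2.1 * p.2.2 + p.2.2 ^ 2) = 37)).card = 24 ∧
    ((Finset.Icc (-6 : ℤ) 6 ×ˢ Finset.Icc (-3 : ℤ) 3 ×ˢ Finset.Icc (-3 : ℤ) 3).filter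
        (fun p => p.1 ^ 2 + 36 * (p.2.1 ^ 2 - p.2.1 * p.2.2 + p.2.2 ^ 2) = 37)).card = 12 := by
  refine ⟨by decide +kernel, by decide +kernel, by decide +kernel⟩

/-- The six-to-one normalisation on the anchors: `24 = 6·4`, `12 = 6·2`, `48 = 6·8`, `24 = 6·4`, `12 = 6·2`,
matching `h(-39) = 4`, `h(-111) = 8` and the census multisets `{6,6,9,9}`, `{6,6,6,6,9,9,12,12}`. [numerals] -/
theorem anchors_normalised : 24 = 6 * 4 ∧ 12 = 6 * 2 ∧ 48 = 6 * 8 ∧ (6 + 6 + 9 + 9) = 2 * 15 ∧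
    (6 + 6 + 6 + 6 + 9 + 9 + 12 + 12) = 2 * 33 := by norm_num


/-! ### Bookkeeping of the Sturm argument for identity (N) (DERIVATION-N12-A §2.3) -/

/-- Levels, index and bound: `lcm(108,144) = 432`; twisting by `χ₋₄` (conductor 4) resp. `χ₈` (conductor 8) keeps the
level inside `lcm(432, 4², 4·12) = 432` resp. `lcm(432, 8², 8·12) = 1728 = 2⁶·3³`; `[SL₂(ℤ) : Γ₀(1728)] = 1728·(3/2)·(4/3) = 3456`;
the weight-6 Sturm bound is `6·3456/12 = 1728`, and `ord(H) ≥ 433` gives `ord(H⁴) ≥ 1732 > 1728`.  The check range `30000`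
even exceeds the bound `15552` for level `2⁸·3⁵`. -/
theorem sturm_numerals :
    Nat.lcm 108 144 = 432 ∧ Nat.lcm 432 (Nat.lcm (4 ^ 2) (4 * 12)) = 432 ∧ Nat.lcm 432 (Nat.lcm (8 ^ 2) (8 * 12)) = 1728 ∧
    1728 = 2 ^ 6 * 3 ^ 3 ∧ 1728 / (2 * 3) * ((2 + 1) * (3 + 1)) = 3456 ∧ 6 * 3456 / 12 = 1728 ∧ 4 * 433 = 1732 ∧ 1728 < 1732 ∧
    432 < 30000 ∧ 62208 = 2 ^ 8 * 3 ^ 5 ∧ 62208 / (2 * 3) * ((2 + 1) * (3 + 1)) = 124416 ∧ 6 * 124416 / 12 / 4 = 15552 ∧ 15552 < 30000 := by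
  refine ⟨by decide, by decide, by decide, ?_⟩
  norm_num

/-- `(c, 6) = 1 ⇒ c² ≡ 1 (mod 24)`: the exponents `c² + 12L` of `T = θ₍₆₎ · B(12z)` are `≡ 1 (mod 12)`. -/
theorem units_mod_24_square : ∀ c : ZMod 24, IsUnit c → c ^ 2 = 1 := by decide

/-- Residue bookkeeping: on `n ≡ 1 (mod 12)` the classes mod 8 and mod 24 correspond, Nekovář's normalising residue
`-3M mod 8` is `5` resp. `1`, the exponents of `g = η(6z)η(18z)` are `≡ 1 (mod 6)`, and `n ≡ 1 (4) ∧ n ≡ 1 (6) ↔ n ≡ 1 (12)`. -/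
theorem progressions (n M : ℤ) (j : ℕ) :
    (n % 12 = 1 → ((n % 8 = 1 ↔ n % 24 = 1) ∧ (n % 8 = 5 ↔ n % 24 = 13))) ∧
    (M % 24 = 1 → (-3 * M) % 8 = 5) ∧ (M % 24 = 13 → (-3 * M) % 8 = 1) ∧
    ((1 + 6 * (j : ℤ)) % 6 = 1) ∧ ((n % 4 = 1 ∧ n % 6 = 1) ↔ n % 12 = 1) := by
  refine ⟨?_, ?_, ?_, ?_, ?_⟩ <;> omega

/-- The odd-exponent part of `F₊ = g·θ(9z)` is `g·θ(36z)`: `9m²` is even iff `m` is. -/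
theorem nine_sq_even_iff (m : ℤ) : Even (9 * m ^ 2) ↔ Even m := by
  rw [Int.even_mul, Int.even_pow' two_ne_zero]
  have h9 : ¬ Even (9 : ℤ) := by decide
  constructor
  · rintro (h | h)
    · exact absurd h h9
    · exact h
  · exact fun h => Or.inr h

/-! ### Arithmetic of THEOREM N12 (DERIVATION-N12-A §2.4) -/

/-- From identity (N) the normalised coefficient is `c' = -t/2` in BOTH residue classes:
`M ≡ 1 (mod 24)`: `2c + 3t = 0` and `c' = c/3`;  `M ≡ 13 (mod 24)`: `2c + t = 0` and `c' = c`. -/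
theorem c_prime_uniform (c t : ℚ) :
    (2 * c + 3 * t = 0 → 2 * (c / 3) = -t) ∧ (2 * c + t = 0 → 2 * c = -t) := by
  constructor <;> intro h <;> linarith

/-- Integrality: `2c = -3t` with `t ∈ ℤ` forces `3 ∣ c` (so `c' = c/3 ∈ ℤ`, [Nekovar1990, Cor. 7.4] in this case), and `2c' = -t` forces `t` even. -/
theorem three_dvd_c (c t : ℤ) (h : 2 * c = -3 * t) : 3 ∣ c := by omega

/-- `2c' = -t` with `c' ∈ ℤ` forces `t = h/2 - 3ν₂` to be even. -/
theorem t_even (c' t : ℤ) (h : 2 * c' = -t) : 2 ∣ t := by omega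

/-- THEOREM N12 (a)+(b) as arithmetic: with `t = h/2 - 3ν₂` (dictionary + genus law), `2c' = -t` (identity (N)) and
`A := L(E_M,1)√M/Ω₊ = 3c'²` (Nekovář's Theorem 6.6 divided by `Ω₊ = Ω/√3`), one has `A = (3/4)t²`, and
`A = 0 ↔ 6ν₂ = h` (vanishing of the central value iff exactly `h/6` classes have depth `≥ 12`). -/
theorem N12_assembly (h ν₂ t c' A : ℚ) (ht : t = h / 2 - 3 * ν₂) (hc : 2 * c' = -t) (hA : A = 3 * c' ^ 2) :
    A = 3 / 4 * t ^ 2 ∧ ν₂ = h / 6 + 2 / 3 * c' ∧ (A = 0 ↔ 6 * ν₂ = h) := by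
  have hc' : c' = -t / 2 := by linarith
  subst hc'
  refine ⟨by rw [hA]; ring, by linarith, ?_⟩
  rw [hA]
  constructor
  · intro h0
    have : t ^ 2 = 0 := by nlinarith [sq_nonneg t]
    have ht0 : t = 0 := pow_eq_zero_iff (n := 2) (by norm_num) |>.mp this
    linarith
  · intro h6
    have : t = 0 := by linarith
    subst this
    norm_num

/-- Nekovář's congruence (7.1) in this family: writing `h = 2h'`, `t = h' - 3ν₂`, `2c' = -t` gives `3 ∣ c' + h`
(i.e. `c' ≡ -h (mod 3)`), and also `ν₂ ≡ h' (mod 2)`. -/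
theorem nekovar_congruence (h' ν₂ c' : ℤ) (H : 2 * c' = 3 * ν₂ - h') :
    (3 : ℤ) ∣ c' + 2 * h' ∧ (2 : ℤ) ∣ ν₂ - h' := by omega

/-- COROLLARY (iv) as arithmetic: `3 ∤ h = 2h'` forces `c' ≠ 0` (hence `L(E_M,1) = 3Ω₊c'²/√M ≠ 0`). -/
theorem nonvanishing_criterion (h' ν₂ c' : ℤ) (H : 2 * c' = 3 * ν₂ - h') (h3 : ¬ (3 : ℤ) ∣ 2 * h') : c' ≠ 0 := by
  omega

/-- Anchors for `t`: `6t(13) = r(13; c²+12Θ) - 3·r(13; c²+36Θ) = 12 - 3·0`, `t(13) = 2` (and `c(13) = -1 = -t/2`, `13 ≡ 13 (mod 24)`);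
`6t(37) = 24 - 3·12`, `t(37) = -2` (and `c(37) = 1 = -t/2`).  The ternary counts are `anchor_13`, `anchor_37`. -/
theorem anchor_t_values : (12 : ℤ) - 3 * 0 = 6 * 2 ∧ (24 : ℤ) - 3 * 12 = 6 * (-2) ∧ (13 : ℤ) % 24 = 13 ∧ (37 : ℤ) % 24 = 13 ∧
    2 * (-1 : ℤ) = -2 ∧ 2 * (1 : ℤ) = -(-2) := by norm_num

end Summit.HodgeConjecture.HodgeConjecture.HodgeLocus.Census.Depth12At3
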